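import Literature.MathematicalPhysics.QuantumLattice.FermiRG.FST3NormAlgebra
import Literature.Analysis.FunctionSpaces.HolderNorm
import Mathlib.Analysis.Calculus.ContDiff.Basic
import Mathlib.Analysis.Calculus.ContDiff.Bounds
import HarnessLib

/-!
# FST III §1 norms vs. Fréchet derivatives: `D^α f = D^{|α|}f (e_{α})`, and the bridge
# `C^{k,h}` (operator-norm form, `MemContDiffHolder`) ⇒ `|f|_{k,h} < ∞` (coordinate form, `IsCkHolder`)

J. Feldman, M. Salmhofer, E. Trubowitz, FST III = CPAM **52** (1999) 273 = arXiv:cond-mat/9705272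
[FeldmanSalmhoferTrubowitz1999] §1 (1.1)–(1.2) (the norms `|f|_k = sup_p Σ_{|α|≤k}|D^α f(p)|`, `|f|_{k,h}`),
and FST II = CPAM **51** (1998) 1133 = arXiv:cond-mat/9701073 [FeldmanSalmhoferTrubowitz1998] §2
p.6 L88–104 (the classes `C^{k,h}`: `k`-th derivatives `h`-Hölder, bounded derivatives).  The gate-hubbard-kl
typer wave typed the SAME printed classes twice: t4 (`FermiRG/FST2Hypotheses.lean`, (A1)/(A2)) through the
tree's `Literature.Analysis.FunctionSpaces.MemContDiffHolder k h` (Mathlib `iteratedFDeriv`, operator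
norms), t5 (`FermiRG/FST3Main.lean`, (H1)/(H2)) through the coordinate partials `FST3.multiPartial` and the
predicates `FST3.CkHolderNormLE` / `FST3.IsCkHolder`; the dictionary file `FermiRG/FST3FST2Bridge.lean`
(t5, p415233) records "norms … NOT bridged".  This file supplies that bridge in the direction every consumer
needs (operator-norm bounds ⇒ coordinate bounds): for `C^{|l|}` functions the iterated coordinate partial
IS the Fréchet derivative evaluated at basis vectors, `iterPartial l f x = D^{|l|}f(x)(e_{l₀},…,e_{l_{|l|-1}})`
(`iterPartial_eq_iteratedFDeriv`), hence `‖D^α f(x)‖ ≤ ‖D^{|α|}f(x)‖` and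
`‖D^α f(x) − D^α f(y)‖ ≤ ‖D^{|α|}f(x) − D^{|α|}f(y)‖` (`norm_multiPartial_le`, `norm_multiPartial_sub_le`), and
so uniform bounds `‖D^j f‖_∞ ≤ C_j` (`j ≤ k`) with a Hölder constant for `D^k f` give
`|f|_{k,h} ≤ Σ_{|α|≤k} C_{|α|} + C_H` (`CkHolderNormLE.of_iteratedFDeriv_bounds`); in particular
`MemContDiffHolder k r f → IsCkHolder k r f` (`IsCkHolder.of_memContDiffHolder`).  (FST IV §2.2 p.7:L151:
"it does not matter whether we use the norm in Cartesian or polar coordinates since the two are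
equivalent" — the same remark covers coordinate vs. operator norms up to dimension constants; only the
constant-free direction is proved here.)  Theorems only; frozen files untouched; net fact debt 0.
-/

noncomputable section

open scoped BigOperators NNReal

namespace Literature.MathematicalPhysics.QuantumLattice.FermiRG

namespace FST3

open Literature.Analysis.FunctionSpaces (MemContDiffHolder eSupNorm_lt_top_iff)

variable {n : ℕ} {F : Type*} [NormedAddCommGroup F] [NormedSpace ℝ F]

/-- The tuple of basis vectors `(e_{l₀}, …, e_{l_{m-1}})` named by a coordinate list `l`.
(Local abbreviation through `fun`; no definition is introduced.) [folklore] -/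
private theorem basisTuple_cons (i : Fin n) (l : List (Fin n)) :
    (fun j : Fin (i :: l).length => EuclideanSpace.single ((i :: l).get j) (1 : ℝ)) =
      Fin.cons (EuclideanSpace.single i (1 : ℝ))
        (fun j : Fin l.length => EuclideanSpace.single (l.get j) (1 : ℝ)) := by
  funext j
  refine Fin.cases ?_ (fun j => ?_) j
  · rfl
  · rfl

/-- **Coordinate partials are the Fréchet derivative at basis vectors**: for `f ∈ C^{|l|}`,
`iterPartial l f x = D^{|l|} f(x) (e_{l₀}, …, e_{l_{|l|-1}})` (outermost direction first, matching
`iteratedFDeriv_succ_apply_left`). [cite: FeldmanSalmhoferTrubowitz1999, §1 (1.1) p.1] -/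
theorem iterPartial_eq_iteratedFDeriv (l : List (Fin n)) {f : Mom n → F} (hf : ContDiff ℝ l.length f)
    (x : Mom n) :
    iterPartial l f x =
      iteratedFDeriv ℝ l.length f x (fun j => EuclideanSpace.single (l.get j) (1 : ℝ)) := by
  induction l generalizing x with
  | nil => simp [iterPartial_nil]
  | cons i l ih =>
    have hf' : ContDiff ℝ l.length f := hf.of_le (by exact_mod_cast Nat.le_succ _)
    have hfun : iterPartial l f = fun y =>
        iteratedFDeriv ℝ l.length f y (fun j => EuclideanSpace.single (l.get j) (1 : ℝ)) :=
      funext fun y => ih hf' y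
    -- differentiability of `y ↦ D^{|l|} f(y)` (as `f ∈ C^{|l|+1}`)
    have hD : DifferentiableAt ℝ (iteratedFDeriv ℝ l.length f) x := by
      refine (hf.differentiable_iteratedFDeriv ?_) x
      exact_mod_cast Nat.lt_succ_self _
    set v : Fin l.length → Mom n := fun j => EuclideanSpace.single (l.get j) (1 : ℝ) with hv
    rw [iterPartial_cons, basisTuple_cons]
    show partialD i (iterPartial l f) x =
      iteratedFDeriv ℝ (l.length + 1) f x (Fin.cons (EuclideanSpace.single i (1 : ℝ)) v)
    rw [iteratedFDeriv_succ_apply_left, Fin.cons_zero, Fin.tail_cons]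
    -- `∂_i (y ↦ D^{|l|}f(y) v) x = (fderiv (D^{|l|} f) x e_i) v`
    simp only [partialD, hfun]
    have hcomp : (fun y => iteratedFDeriv ℝ l.length f y v) =
        (ContinuousMultilinearMap.apply ℝ (fun _ : Fin l.length => Mom n) F v) ∘
          iteratedFDeriv ℝ l.length f := by
      funext y; rfl
    rw [hcomp, ((ContinuousMultilinearMap.apply ℝ (fun _ : Fin l.length => Mom n) F v).hasFDerivAt.comp x
      hD.hasFDerivAt).fderiv]
    rfl

/-- `‖D^α f(x)‖ ≤ ‖D^{|α|} f(x)‖` (operator norm) for `f ∈ C^{|α|}` — the basis vectors have norm one.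
[cite: FeldmanSalmhoferTrubowitz1999, §1 (1.1) p.1] -/
theorem norm_multiPartial_le (α : Fin n → ℕ) {f : Mom n → F} (hf : ContDiff ℝ (miOrder α) f)
    (x : Mom n) : ‖multiPartial α f x‖ ≤ ‖iteratedFDeriv ℝ (miOrder α) f x‖ := by
  unfold multiPartial
  rw [← length_multiIndexList α] at hf ⊢
  rw [iterPartial_eq_iteratedFDeriv _ hf x]
  refine (ContinuousMultilinearMap.le_opNorm _ _).trans ?_
  rw [Finset.prod_eq_one (fun j _ => by simp), mul_one]

/-- `‖D^α f(x) − D^α f(y)‖ ≤ ‖D^{|α|} f(x) − D^{|α|} f(y)‖` for `f ∈ C^{|α|}`.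
[cite: FeldmanSalmhoferTrubowitz1999, §1 (1.2) p.1] -/
theorem norm_multiPartial_sub_le (α : Fin n → ℕ) {f : Mom n → F} (hf : ContDiff ℝ (miOrder α) f)
    (x y : Mom n) :
    ‖multiPartial α f x - multiPartial α f y‖ ≤
      ‖iteratedFDeriv ℝ (miOrder α) f x - iteratedFDeriv ℝ (miOrder α) f y‖ := by
  unfold multiPartial
  rw [← length_multiIndexList α] at hf ⊢
  rw [iterPartial_eq_iteratedFDeriv _ hf x, iterPartial_eq_iteratedFDeriv _ hf y,
    ← sub_apply]
  refine (ContinuousMultilinearMap.le_opNorm _ _).trans ?_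
  rw [Finset.prod_eq_one (fun j _ => by simp), mul_one]

/-- **Operator-norm bounds ⇒ `|f|_{k,h} ≤ N`**: if `f ∈ C^k`, `‖D^j f‖_∞ ≤ C_j` for `j ≤ k` and (when
`h > 0`) `‖D^k f(x) − D^k f(y)‖ ≤ C_H ‖x−y‖^h` with `C_H ≥ 0`, then `|f|_{k,h} ≤ Σ_{|α|≤k} C_{|α|} + C_H` in the
sense of `CkHolderNormLE`. [cite: FeldmanSalmhoferTrubowitz1999, §1 (1.1)-(1.2) p.1] -/
theorem CkHolderNormLE.of_iteratedFDeriv_bounds {k : ℕ} {h : ℝ} {f : Mom n → F} (hf : ContDiff ℝ k f)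
    {C : ℕ → ℝ} (hC : ∀ j ≤ k, ∀ x, ‖iteratedFDeriv ℝ j f x‖ ≤ C j) {CH : ℝ} (hCH : 0 ≤ CH)
    (hHol : 0 < h → ∀ x y, ‖iteratedFDeriv ℝ k f x - iteratedFDeriv ℝ k f y‖ ≤ CH * ‖x - y‖ ^ h) :
    CkHolderNormLE k h f ((∑ α ∈ multiIndicesLE n k, C (miOrder α)) + CH) := by
  refine ⟨fun α => C (miOrder α), CH, ?_, hCH, ?_, le_rfl⟩
  · intro α hα x
    exact (norm_multiPartial_le α (hf.of_le (by exact_mod_cast hα)) x).trans (hC _ hα x)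
  · intro hh α hα x y
    have hfα : ContDiff ℝ (miOrder α) f := hf.of_le (by exact_mod_cast hα.le)
    refine (norm_multiPartial_sub_le α hfα x y).trans ?_
    rw [hα]
    exact hHol hh x y

/-- **`C^{k,h}` in the operator-norm sense implies `|f|_{k,h} < ∞` in the coordinate sense**: the tree's
`MemContDiffHolder k r f` (t4's typing of FST II (A1)/(A2)) implies `FST3.IsCkHolder k r f` (t5's typing of
FST III (H1)/(H2)). [cite: FeldmanSalmhoferTrubowitz1999, §1 (1.2) p.1] -/
theorem IsCkHolder.of_memContDiffHolder {k : ℕ} {r : ℝ≥0} {f : Mom n → F}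
    (hf : MemContDiffHolder k r f) : IsCkHolder k (r : ℝ) f := by
  obtain ⟨hcd, hbd, hhol⟩ := hf
  have hC : ∀ j, j ≤ k → ∃ Cj : ℝ, ∀ x, ‖iteratedFDeriv ℝ j f x‖ ≤ Cj :=
    fun j hj => eSupNorm_lt_top_iff.1 (hbd j hj)
  choose! C hC using hC
  obtain ⟨CH, hCH⟩ := hhol
  refine ⟨hcd, _, CkHolderNormLE.of_iteratedFDeriv_bounds hcd hC (CH := (CH : ℝ)) CH.coe_nonneg ?_⟩
  intro _ x y
  rw [← dist_eq_norm, ← dist_eq_norm]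
  exact hCH.dist_le_of_le le_rfl

/-! ### FST IV Lemma 3 (iii): the product estimate, from the operator-norm Leibniz bound -/

/-- **FST IV Lemma 3 (iii) (the product estimate)** [FeldmanSalmhoferTrubowitz2000, §2.2 Lemma 3,
p.7:L162–168, proof L178–188]: "`|FG|_p ≤ 2^p |F|_p |G|_p`", proved in print from the Leibniz rule
"`‖FG‖_p ≤ Σ_{q=0}^p (p choose q) ‖F‖_q ‖G‖_{p−q}`" (p.7:L185–188).  Typed in the operator-norm ⇒ coordinate
direction of this file: if `f, g ∈ C^k` (values in a normed algebra `𝔸`, e.g. `ℝ` or `ℂ`) with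
`‖D^j f‖_∞ ≤ C^f_j`, `‖D^j g‖_∞ ≤ C^g_j` (`j ≤ k`), then `|fg|_k ≤ Σ_{|α|≤k} Σ_{i≤|α|} (|α| choose i) C^f_i C^g_{|α|−i}`
in the sense of `CkHolderNormLE k 0` (Mathlib's `norm_iteratedFDeriv_mul_le` + `CkHolderNormLE.of_iteratedFDeriv_bounds`).
[cite: FeldmanSalmhoferTrubowitz2000, Lemma 3 (iii) p.7:L162-188] -/
theorem CkHolderNormLE.mul_of_iteratedFDeriv_bounds {𝔸 : Type*} [NormedRing 𝔸] [NormedAlgebra ℝ 𝔸]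
    {k : ℕ} {f g : Mom n → 𝔸} (hf : ContDiff ℝ k f) (hg : ContDiff ℝ k g) {Cf Cg : ℕ → ℝ}
    (hCf : ∀ j ≤ k, ∀ x, ‖iteratedFDeriv ℝ j f x‖ ≤ Cf j)
    (hCg : ∀ j ≤ k, ∀ x, ‖iteratedFDeriv ℝ j g x‖ ≤ Cg j) :
    CkHolderNormLE k 0 (fun x => f x * g x)
      ((∑ α ∈ multiIndicesLE n k, ∑ i ∈ Finset.range (miOrder α + 1),
        ((miOrder α).choose i : ℝ) * Cf i * Cg (miOrder α - i)) + 0) := by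
  refine CkHolderNormLE.of_iteratedFDeriv_bounds (hf.mul hg)
    (C := fun j => ∑ i ∈ Finset.range (j + 1), (j.choose i : ℝ) * Cf i * Cg (j - i)) ?_ le_rfl
    (fun h => absurd h (lt_irrefl 0))
  intro j hj x
  have hCf0 : ∀ i ≤ k, 0 ≤ Cf i := fun i hi => (norm_nonneg _).trans (hCf i hi x)
  refine (norm_iteratedFDeriv_mul_le hf hg x (n := j) (by exact_mod_cast hj)).trans ?_
  refine Finset.sum_le_sum fun i hi => ?_
  have hik : i ≤ k := (Nat.lt_succ_iff.1 (Finset.mem_range.1 hi)).trans hj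
  have hjik : j - i ≤ k := (Nat.sub_le j i).trans hj
  calc (j.choose i : ℝ) * ‖iteratedFDeriv ℝ i f x‖ * ‖iteratedFDeriv ℝ (j - i) g x‖
      ≤ (j.choose i : ℝ) * Cf i * ‖iteratedFDeriv ℝ (j - i) g x‖ := by
        gcongr
        exact hCf i hik x
    _ ≤ (j.choose i : ℝ) * Cf i * Cg (j - i) :=
        mul_le_mul_of_nonneg_left (hCg _ hjik x) (mul_nonneg (Nat.cast_nonneg _) (hCf0 i hik))

end FST3

end Literature.MathematicalPhysics.QuantumLattice.FermiRG
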